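import Summits.Ventures.PercRepro.GenQLargeGen

/-!
# PercRepro — THE RANK-STEP RECURSION: the `(k+1)`-sets of rank `j` against the `k`-sets of rank `j` (night-4, gen 7)

For `X ⊆ gr M` let `rkSets M X j k` be the `k`-subsets of `X` of rank `j`.  On a simple matroid a `(k+1)`-set of rank
`j ≤ k` is a spanning non-basis of its closure, so it has `≤ j − 2` coloops (`mTr_add_two_le_of_spanning_nonbasis`) and
hence `≥ k + 3 − j` rank-`j` `k`-subsets (`card_rkSets_erase_ge`: drop a non-coloop); a rank-`j` `k`-set `B` extends to
a rank-`j` `(k+1)`-set only by a point of `cl(B) ∩ X ∖ B` (`card_rkSets_insert_le`).  Double counting the pairs: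
**`card_rkSets_succ_mul_le`**: `(k + 3 − j)·N_{j,k+1} ≤ (c − k)·N_{j,k}` whenever every rank-`j` `k`-set's closure meets
`X` in `≤ c` points — on the core `c = f(j)` (`card_rkSets_succ_mul_le_of_sizeChain`).  With `N_{j,j} ≤ C(|X|, j)`
this gives, for every rank, explicit per-flat constants for the row templates of `GenQFlatRows` (the rank-`r` analogues
of the `(8, 6)` knapsack rows; sheet §62 (h): within `≈ 10 %` of the exact rank-`4` values at `s = 9, 10`).
Imports `GenQLargeGen` (`SizeChain`, `clF_mem_flatsQ`, `subset_clF`).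
-/
namespace PercRepro.Night4

open Finset ThmH SixFour GenQ PerFlat Star

variable {α : Type} [DecidableEq α] {M : Matroid α} [M.Finite]

/-- The `k`-subsets of `X` of rank `j`. -/
noncomputable def rkSets (M : Matroid α) [M.Finite] (X : Finset α) (j k : ℕ) : Finset (Finset α) :=
  (X.powersetCard k).filter (fun A : Finset α => M.eRk (A : Set α) = (j : ℕ∞))

omit [DecidableEq α] in
/-- Membership in `rkSets`. -/
theorem mem_rkSets {X A : Finset α} {j k : ℕ} :
    A ∈ rkSets M X j k ↔ A ⊆ X ∧ A.card = k ∧ M.eRk (A : Set α) = (j : ℕ∞) := by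
  unfold rkSets
  rw [Finset.mem_filter, Finset.mem_powersetCard, and_assoc]

omit [DecidableEq α] in
/-- `N_{j,k} ≤ C(|X|, k)`. -/
theorem card_rkSets_le (X : Finset α) (j k : ℕ) : (rkSets M X j k).card ≤ X.card.choose k := by
  unfold rkSets
  exact (Finset.card_filter_le _ _).trans (le_of_eq (Finset.card_powersetCard _ _))

/-- Removing a non-coloop of `A` keeps the rank. -/
theorem eRk_erase_eq_of_notMem_coloopsOf {A : Finset α} {x : α} (hx : x ∈ A) (hc : x ∉ coloopsOf M A) :
    M.eRk ((A.erase x : Finset α) : Set α) = M.eRk (A : Set α) := by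
  rw [mem_coloopsOf] at hc
  have hcl : x ∈ M.closure ((A.erase x : Finset α) : Set α) := by
    by_contra h
    exact hc ⟨hx, h⟩
  have h1 := eRk_insert_eq_of_mem_closure' (M := M) (X := ((A.erase x : Finset α) : Set α)) hcl
  rw [← Finset.coe_insert, Finset.insert_erase hx] at h1
  exact h1.symm

/-- **A `(k+1)`-set of rank `j` (`1 ≤ j ≤ k`) has at least `k + 3 − j` rank-`j` `k`-subsets** on a simple matroid. -/
theorem card_rkSets_erase_ge (hs : Simple M) {X A : Finset α} (hX : X ⊆ gr M) {j k : ℕ} (hj : 1 ≤ j)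
    (hjk : j ≤ k) (hA : A ∈ rkSets M X j (k + 1)) :
    k + 3 - j ≤ ((A.powersetCard k).filter (fun B : Finset α => M.eRk (B : Set α) = (j : ℕ∞))).card := by
  obtain ⟨hAX, hAc, hAr⟩ := mem_rkSets.1 hA
  have hAg : A ⊆ gr M := hAX.trans hX
  have hm := mTr_add_two_le_of_spanning_nonbasis hs hAg hAr hj (by omega)
  -- the non-coloops of `A` inject into the rank-`j` `k`-subsets by `x ↦ A.erase x`
  have hinj : (A \ coloopsOf M A).card ≤
      ((A.powersetCard k).filter (fun B : Finset α => M.eRk (B : Set α) = (j : ℕ∞))).card := by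
    apply Finset.card_le_card_of_injOn (fun x => A.erase x)
    · intro x hx
      rw [Finset.mem_coe, Finset.mem_sdiff] at hx
      rw [Finset.mem_coe, Finset.mem_filter, Finset.mem_powersetCard]
      refine ⟨⟨Finset.erase_subset x A, ?_⟩, ?_⟩
      · rw [Finset.card_erase_of_mem hx.1, hAc]
        rfl
      · rw [eRk_erase_eq_of_notMem_coloopsOf hx.1 hx.2, hAr]
    · intro x hx y hy hxy
      rw [Finset.mem_coe, Finset.mem_sdiff] at hx hy
      simp only at hxy
      by_contra hne
      have : x ∈ A.erase y := Finset.mem_erase.2 ⟨hne, hx.1⟩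
      rw [← hxy] at this
      exact (Finset.mem_erase.1 this).1 rfl
  have hsd : (A \ coloopsOf M A).card = A.card - mTr M A := by
    unfold mTr
    exact Finset.card_sdiff_of_subset (coloopsOf_subset A)
  omega

/-- **A rank-`j` `k`-set `B ⊆ X` extends to at most `|cl(B) ∩ X| − k` rank-`j` `(k+1)`-subsets of `X`**: the new
point lies in `cl(B) ∩ X ∖ B`. -/
theorem card_rkSets_insert_le {X B : Finset α} (hX : X ⊆ gr M) {j k : ℕ} (hB : B ∈ rkSets M X j k) :
    ((rkSets M X j (k + 1)).filter (fun A : Finset α => B ⊆ A)).card ≤ (clF M B ∩ X).card - k := by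
  obtain ⟨hBX, hBc, hBr⟩ := mem_rkSets.1 hB
  have hBsub : B ⊆ clF M B ∩ X := Finset.subset_inter (subset_clF (M := M) (hBX.trans hX)) hBX
  have hcard : ((clF M B ∩ X) \ B).card = (clF M B ∩ X).card - k := by
    rw [Finset.card_sdiff_of_subset hBsub, hBc]
  rw [← hcard]
  -- every such `A` is `insert x B` for an `x ∈ (cl(B) ∩ X) ∖ B`
  have hsub : (rkSets M X j (k + 1)).filter (fun A : Finset α => B ⊆ A) ⊆
      ((clF M B ∩ X) \ B).image (fun x => insert x B) := by
    intro A hA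
    rw [Finset.mem_filter] at hA
    obtain ⟨hAX, hAc, hAr⟩ := mem_rkSets.1 hA.1
    have hBA := hA.2
    have h1 : (A \ B).card = 1 := by
      rw [Finset.card_sdiff_of_subset hBA, hAc, hBc]
      omega
    obtain ⟨x, hx⟩ := Finset.card_eq_one.1 h1
    have hxA : x ∈ A \ B := by rw [hx]; exact Finset.mem_singleton_self x
    rw [Finset.mem_sdiff] at hxA
    have hAeq : A = insert x B := by
      ext y
      constructor
      · intro hy
        by_cases hyB : y ∈ B
        · exact Finset.mem_insert_of_mem hyB
        · have : y ∈ A \ B := Finset.mem_sdiff.2 ⟨hy, hyB⟩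
          rw [hx, Finset.mem_singleton] at this
          rw [this]
          exact Finset.mem_insert_self x B
      · intro hy
        rcases Finset.mem_insert.1 hy with rfl | hyB
        · exact hxA.1
        · exact hBA hyB
    have hxE : x ∈ M.E := by
      rw [← coe_gr M]
      exact Finset.mem_coe.2 (hX (hAX hxA.1))
    have hxcl : x ∈ M.closure (B : Set α) := by
      by_contra hncl
      have h := Matroid.eRk_insert_eq_add_one (M := M) (e := x) (X := (B : Set α)) ⟨hxE, hncl⟩
      rw [← Finset.coe_insert, ← hAeq, hAr, hBr] at h
      have h2 : j = j + 1 := by exact_mod_cast h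
      omega
    rw [Finset.mem_image]
    refine ⟨x, ?_, hAeq.symm⟩
    rw [Finset.mem_sdiff, Finset.mem_inter, mem_clF]
    exact ⟨⟨hxcl, hAX hxA.1⟩, hxA.2⟩
  exact (Finset.card_le_card hsub).trans Finset.card_image_le

/-- **THE RANK-STEP RECURSION**: `(k + 3 − j)·N_{j,k+1} ≤ (c − k)·N_{j,k}` on a simple matroid, when the closure of
every rank-`j` `k`-subset of `X` meets `X` in `≤ c` points (`1 ≤ j ≤ k`). -/
theorem card_rkSets_succ_mul_le (hs : Simple M) {X : Finset α} (hX : X ⊆ gr M) {j k c : ℕ} (hj : 1 ≤ j)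
    (hjk : j ≤ k) (hc : ∀ B ∈ rkSets M X j k, (clF M B ∩ X).card ≤ c) :
    (k + 3 - j) * (rkSets M X j (k + 1)).card ≤ (c - k) * (rkSets M X j k).card := by
  -- the pairs `(A, B)`, `B ⊆ A` a rank-`j` `k`-subset of the rank-`j` `(k+1)`-set `A`
  have hlow : (k + 3 - j) * (rkSets M X j (k + 1)).card ≤
      ((rkSets M X j (k + 1)).sigma (fun A : Finset α =>
        (A.powersetCard k).filter (fun B : Finset α => M.eRk (B : Set α) = (j : ℕ∞)))).card := by
    rw [Finset.card_sigma, Finset.card_eq_sum_ones (rkSets M X j (k + 1)), Finset.mul_sum]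
    apply Finset.sum_le_sum
    intro A hA
    rw [mul_one]
    exact card_rkSets_erase_ge hs hX hj hjk hA
  have hup : ((rkSets M X j (k + 1)).sigma (fun A : Finset α =>
        (A.powersetCard k).filter (fun B : Finset α => M.eRk (B : Set α) = (j : ℕ∞)))).card ≤
      ((rkSets M X j k).sigma (fun B : Finset α =>
        (rkSets M X j (k + 1)).filter (fun A : Finset α => B ⊆ A))).card := by
    apply Finset.card_le_card_of_injOn (fun p => ⟨p.2, p.1⟩)
    · intro p hp
      rw [Finset.mem_coe, Finset.mem_sigma, Finset.mem_filter, Finset.mem_powersetCard] at hp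
      obtain ⟨hA, ⟨hBA, hBc⟩, hBr⟩ := hp
      have hA' := mem_rkSets.1 hA
      rw [Finset.mem_coe, Finset.mem_sigma, Finset.mem_filter]
      exact ⟨mem_rkSets.2 ⟨hBA.trans hA'.1, hBc, hBr⟩, hA, hBA⟩
    · intro p _ p' _ h
      simp only [Sigma.mk.injEq] at h
      obtain ⟨A, B⟩ := p
      obtain ⟨A', B'⟩ := p'
      simp only at h
      obtain ⟨h1, h2⟩ := h
      subst h1
      subst h2
      rfl
  have hsum : ((rkSets M X j k).sigma (fun B : Finset α =>
        (rkSets M X j (k + 1)).filter (fun A : Finset α => B ⊆ A))).card ≤ (c - k) * (rkSets M X j k).card := by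
    rw [Finset.card_sigma, Finset.card_eq_sum_ones (rkSets M X j k), Finset.mul_sum]
    apply Finset.sum_le_sum
    intro B hB
    rw [mul_one]
    exact (card_rkSets_insert_le hX hB).trans (Nat.sub_le_sub_right (hc B hB) k)
  exact hlow.trans (hup.trans hsum)

/-- **The rank-step recursion on the core**: with the size chain `f` (`j < q`), `(k + 3 − j)·N_{j,k+1} ≤ (f j − k)·N_{j,k}`. -/
theorem card_rkSets_succ_mul_le_of_sizeChain (hs : Simple M) {q : ℕ} {f : ℕ → ℕ} (hf : SizeChain M q f)
    {X : Finset α} (hX : X ⊆ gr M) {j k : ℕ} (hj : 1 ≤ j) (hjq : j < q) (hjk : j ≤ k) :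
    (k + 3 - j) * (rkSets M X j (k + 1)).card ≤ (f j - k) * (rkSets M X j k).card := by
  apply card_rkSets_succ_mul_le hs hX hj hjk
  intro B hB
  obtain ⟨hBX, _, hBr⟩ := mem_rkSets.1 hB
  apply hf (clF M B ∩ X) (Finset.inter_subset_right.trans hX) j hjq
  calc M.eRk ((clF M B ∩ X : Finset α) : Set α) ≤ M.eRk ((clF M B : Finset α) : Set α) :=
        M.eRk_mono (Finset.coe_subset.2 Finset.inter_subset_left)
    _ = (j : ℕ∞) := by rw [coe_clF, M.eRk_closure_eq, hBr]

end PercRepro.Night4
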